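import Summits.CriticalPhenomena.PercolationContinuityZ3.Theorems.Transplant.PlanarSkeletonFrmQuasiDefs
import Summits.CriticalPhenomena.PercolationContinuityZ3.Theorems.Transplant.SkelFrmFrom1Normalise
import Summits.CriticalPhenomena.PercolationContinuityZ3.Theorems.Transplant.SkelFrm1Normalise
import Summits.CriticalPhenomena.PercolationContinuityZ3.Theorems.Transplant.SkelRootSeedLawF
import HarnessLib
import Summits.CriticalPhenomena.PercolationContinuityZ3.Theorems.Transplant.SkelFrm1ChoiceDefs
/-!
# GEN-Q PORT (WAVE-Q table v0.8 section 2, row G012, U-level L3; captain R-6/R-7 2026-08-27: carrier token swap `PlanarSkeletonFrmFrom ↦ PlanarSkeletonFrmQuasi`)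
# of the tree module «Transplant/SkelFrmFrom1ChoiceDefs» (sha256 a20822996aee403c…) onto the quasi-step carrier `PlanarSkeletonFrmQuasi` (p507026): «SkelFrmQuasi1ChoiceDefs»

ORIGINAL TITLE: N2 (the frames-only node `SamePDropOfSkeletonFrm₁`, OPEN), WAVE 0 (c2) file 4a: CHOICES AS DATA OVER `OutNS` — `PlanarSkeletonFrmFrom.ChoiceNQ`, the premise `AtQNQ`, the chosen

builds on p205010 (kernel theorem, internal audit signed; external expert review pending) — nothing in this file uses p205010; NOTHING is claimed about any open node
((N3-b), the end state).  Lane `prim-bschramm`, seat `prim-bschramm-gen-1` (gen 4; binder-wave captain).  Helper file (`--supports stmt-CriticalPhenomena-4575 --as helper`).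
PORT RULES (U-wave r1–r4 re-used, GEN-Q hunk classes of p3-g29 #6136): declaration order, names and proof texts are those of «SkelFrmFrom1ChoiceDefs», byte-identical except
(i) the carrier token `PlanarSkeletonFrmFrom ↦ PlanarSkeletonFrmQuasi` in binders, `namespace`/`end` lines and qualified names (module names `SkelFrmFrom… ↦ SkelFrmQuasi…`
in imports of already-ported rows); (ii) `Φ.step ↦ Φ.qstep` with the called Steps lemma replaced by its `…Q`/`_q` twin and the cost `Φ.M` threaded (none in this file unless
listed below); (iii) `Φ.cyl_connected ↦ Φ.cyl_reach` readers (none unless listed); (iv) graph-ball radii / window floors ×`Φ.M` (none unless listed).  Carrier-free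
residents stay imported/exported from the original «SkelFrm1ChoiceDefs» exactly as in the FrmFrom port.  Docstrings and citations are the original's.

-/

noncomputable section

open MeasureTheory ProbabilityTheory
open scoped ENNReal Classical

namespace Summit.CriticalPhenomena.PercolationContinuityZ3.Theorems.Transplant

open Literature.Probability.Percolation Literature.Probability.LatticeModels SimpleGraph KNCells KNLevels
open Literature.Barriers.CriticalPhenomena (HasExponentialGrowth)
open SkelConc (Consts)

namespace PlanarSkeletonFrmQuasi

variable {V : Type} [DecidableEq V] [Countable V] {G : SimpleGraph V} [G.LocallyFinite]

/-- **The N2 instance's choices as data** (twin of N1's `ChoiceNO`, SkelNeg1ChoiceO :186–:204, over `PlanarSkeletonFrm` and the record WITH selectors `OutNS`): Step-I‴ accuracy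
and least seed level, the finite index lists, and the anchored cells / face data / level data at the running density — all functions of `O : OutNS V`. [this work] -/
structure ChoiceNQ (κ : Consts) (Φ : PlanarSkeletonFrmQuasi G) (t : V) (p : unitInterval) (hC : Φ.CylSubcritical p) where
  /-- Step-I‴ accuracy -/
  δI : ℝ
  /-- least seed level asked of Step I‴ -/
  m₀ : ℕ
  /-- the finite list of zone sizes -/
  Sz : Skelφ.StepI.OutNS V → Finset ℕ
  /-- the finite list of admissible (zone size, width) pairs -/
  SMn : Skelφ.StepI.OutNS V → Finset (ℕ × ℕ)
  /-- the anchored cells at the running density -/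
  Γ : Skelφ.StepI.OutNS V → unitInterval → CellGeom V ℕ
  /-- the face data at the running density -/
  FD : Skelφ.StepI.OutNS V → unitInterval → FaceData V ℕ
  /-- the level data at the running density -/
  LD : Skelφ.StepI.OutNS V → unitInterval → LevelData V ℕ
  δI_pos : 0 < δI
  δI_lt_one : δI < 1
  S_adm : ∀ O : Skelφ.StepI.OutNS V, O.FactsNS (G := G) Φ.frame hC m₀ t →
    (∀ M ∈ Sz O, O.D.M₀ ≤ M) ∧ (∀ q ∈ SMn O, O.D.M₀ ≤ q.1 ∧ O.D.n₁ q.1 ≤ q.2)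

namespace ChoiceNQ

variable {κ : Consts} {Φ : PlanarSkeletonFrmQuasi G} {t : V} {p : unitInterval} {hC : Φ.CylSubcritical p}

/-- **The premises of step (B) at `q`** (C2-SPEC §1): the record's facts WITH selectors (quadrant `(E,N)`, orientation constant on selected pairs), `q ∈ [p/2, p]`, the ORIENTED
Step-I‴ family over the quadrant index set at accuracy `δI`, and Φ2 at `q`. [this work] -/
def AtQNQ (𝒞 : ChoiceNQ κ Φ t p hC) (O : Skelφ.StepI.OutNS V) (q : unitInterval) : Prop :=
  O.FactsNS (G := G) Φ.frame hC 𝒞.m₀ t ∧ (p : ℝ) / 2 ≤ q ∧ (q : ℝ) ≤ p ∧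
    (∀ i ∈ Skelφ.StepI.indexNQ {t} (𝒞.Sz O) (𝒞.SMn O) (Skelφ.StepI.sgQ O.qd O.qdT O.ori),
      1 - 𝒞.δI < (bondPercolation G q).real (Skelφ.StepI.eventO G Φ.φ O.D.toDataN O.DT.toDataN O.ori i)) ∧
    Φ.CylSubcritical q

/-- The chosen scheme at `q` (threshold `κ.δ`). [this work] -/
abbrev scheme (𝒞 : ChoiceNQ κ Φ t p hC) (O : Skelφ.StepI.OutNS V) (q : unitInterval) : KSchA V ℕ := ⟨𝒞.Γ O q, q, κ.δ⟩

/-- **The geometric obligation** (N1's `GeomHoldsNO` verbatim). [this work] -/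
def GeomHoldsNQ (𝒞 : ChoiceNQ κ Φ t p hC) : Prop :=
  ∀ (O : Skelφ.StepI.OutNS V) (q : unitInterval), 𝒞.AtQNQ O q →
    (𝒞.Γ O q).root = t ∧ κ.K₀ ≤ (𝒞.Γ O q).K ∧
      RunGeom G (𝒞.Γ O q) ∧ AnchGeom (𝒞.Γ O q) ∧ SepGeom₂ G (𝒞.Γ O q) ∧ ExitGeom G (𝒞.Γ O q) ∧ StepsGeom (𝒞.Γ O q) (𝒞.FD O q) ∧
      LevelGeom G (𝒞.Γ O q) (𝒞.FD O q) (𝒞.LD O q)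

/-- **The root residue, forward, law-carrying, (S0) kits** ((R) column). [this work] -/
def RootHoldsNQW (𝒞 : ChoiceNQ κ Φ t p hC) : Prop :=
  ∀ (O : Skelφ.StepI.OutNS V) (q : unitInterval), 𝒞.AtQNQ O q → Skel.RootOblTWF G (𝒞.scheme O q) Φ.Δ κ.δr

end ChoiceNQ

-- GEN-Q (R-2, captain 2026-08-27): `PlanarSkeletonFrmFrom.ChoiceFnNQ` is not in the used cone of the node top — not ported.

export PlanarSkeletonFrm (FlatQ)

export PlanarSkeletonFrm (ChainFactQ)

-- GEN-Q (R-2, captain 2026-08-27): `PlanarSkeletonFrmFrom.GeomHoldsNQFn` is not in the used cone of the node top — not ported.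

-- GEN-Q (R-2, captain 2026-08-27): `PlanarSkeletonFrmFrom.RootHoldsNQWFnL` is not in the used cone of the node top — not ported.

end PlanarSkeletonFrmQuasi

end Summit.CriticalPhenomena.PercolationContinuityZ3.Theorems.Transplant

end
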